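import Literature.Combinatorics.SimpleGraph.LaplacianCoefficientsForests
import Literature.Combinatorics.SimpleGraph.ConeSpanningTrees
import Literature.Analysis.Matrix.DetAddDiagonalMinors
import Literature.Combinatorics.SimpleGraph.CycleSpanningTrees
import Literature.Combinatorics.SimpleGraph.LaplacianJoinExamples
import HarnessLib

/-!
# The matrix-forest theorem (Chebotarev–Shamis): `det(I + L)` counts the rooted spanning forests,
# and `det(I + τL) = Σ_k σ_k τ^k` (Chebotarev–Agaev 2002 Thm 3, Thm 3′; Knill 2013 Thm 1, Thm 2)

Sources (held texts; statements VERBATIM).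
* P. Chebotarev, R. Agaev, *Forest matrices around the Laplacian matrix*, Linear Algebra Appl.
  **356** (2002) 253–274 [ChebotarevAgaev2002] (held `paper:arxiv-math_0508178`). §2 (p0004
  L34) «An in-forest is a spanning converging forest.»; `σ_k` is the total weight (the number, for
  unit weights) of in-forests with `k` arcs and `σ = Σ_k σ_k` that of all in-forests; (p0004
  L78–81) «We will also consider the parametric value `σ(τ) = Σ_{k=0}^{n−d} σ_k τ^k`, which is the
  total weight of in-forests in `Γ` provided that all arc weights are multiplied by `τ`.»; §3
  (p0006 L36) «**Theorem 2.** For any `J ⊆ {1,…,n}`, `det L(J̄ | J̄) = ε(F^{→J})` holds, where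
  `F^{→J}` is the set of in-forests for which `J` is the set of roots.» (Fiedler–Sedláček,
  Chaiken–Kleitman; in the tree: `RootedForestMatrixTree.det_lapMatrix_submatrix_eq_card_rootedForests`);
  §4 (p0007 L8) «**Theorem 3.** `Q = adj(I+L)` and `σ = det(I+L)`.»; (p0008 L13) «**Theorem 3′.**
  For any `τ ∈ ℝ`, `Q(τ) = adj(I + τL)` and `σ(τ) = det(I + τL)`.»
* O. Knill, *Counting rooted forests in a network*, arXiv:1307.3810 (2013) [Knill2013] (held
  `paper:arxiv-1307.3810`) p0003 L78: «**Theorem 1 (Chebotarev-Shamis Forest Theorem).** For a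
  finite simple graph `G` with Laplacian `L`, the integer `det(1+L)` is the number of rooted
  spanning forests contained in `G`.», «**Theorem 2 (Forest Coloring Theorem).** For a finite
  simple graph `G` with Laplacian `L`, the integer `det(1+kL)` is the number of rooted `k`-colored
  spanning forests contained in `G`.»; §2 (p0004 L3) «The integer `det(1+L)` is also the number of
  simple outdegree=1 acyclic digraphs contained in `G`.»; §3 (p0005) «2) Complete
  `f(K_n) = (n+1)^{n−1}`».

Vocabulary (the tree's).  For a simple graph `G` on a finite vertex type `V` (`n = |V|`,
`L = G.lapMatrix R`), an IN-FOREST («spanning converging forest», «outdegree=1 acyclic digraph»)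
of `G` is a parent map `τ : V → V` every orbit of which ends in a fixed point (a root) — in the
tree's words `CayleyForests.IsForestOn univ roots τ` — whose arcs `v → τ v` (`τ v ≠ v`) run along
edges of `G`; its number of arcs is the number of moved points.  `RootedForestMatrixTree` counts
the in-forests with a PRESCRIBED root set (`det L(J̄|J̄)`, Theorem 2 above) and
`RootedSpanningForests` identifies them with the pairs (acyclic spanning subgraph `F ≤ G`, one
root in each component of `F`) — Knill's «rooted spanning forests contained in `G`».

What is formalised (every commutative ring `R`):
* **`det_one_add_smul_lapMatrix`** (Theorem 3′): `det(1 + t·L) = Σ_{s ⊆ V} t^{|s|} · #{in-forests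
  of G whose non-root set is s}` (`det (M + diagonal d) = Σ_S (∏_{i∉S} dᵢ) det M|_S` from
  `Literature.Analysis.Matrix` and Theorem 2), and **`det_one_add_smul_lapMatrix_eq_sum_pow`**
  (Knill Thm 2): `det(1 + t·L) = Σ_{τ in-forest of G} t^{#arcs(τ)}`;
* **`det_one_add_lapMatrix_eq_card_inForests`** (Theorem 3 / Knill Thm 1 with the Remark):
  `det(1 + L) = #{in-forests of G}`; **`det_one_add_lapMatrix_eq_card_rootedSpanningForests`**
  (Knill Thm 1 as printed): `det(1 + L) = #{(F, roots) : F ≤ G acyclic spanning, exactly one root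
  in each component of F}`; `det_one_add_lapMatrix_eq_sum_forests_prod`: `det(1 + L) = Σ_{F ≤ G
  acyclic} ∏_{components c of F} |c|`;
* examples: **`det_one_add_lapMatrix_top`** `det(1 + L(K_n)) = (n+1)^{n−1}` and
  **`card_inForests_top`**: `n` labelled points carry `(n+1)^{n−1}` rooted forests (Knill §3 (2));
  **`card_spanningTrees_eq_card_inForests_of_dominating`**: with the tree's cone formula
  `t(G) = det(1 + L(G − v))` (`ConeSpanningTrees`), the spanning trees of a graph with a
  dominating vertex `v` are equinumerous with the in-forests of `G − v`.

THEOREMS ONLY (no definition, no named fact, net debt 0).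
-/

namespace Literature.Combinatorics.SimpleGraph.MatrixForestTheorem

open Finset Function Polynomial Literature.Combinatorics.Enumerative
  Literature.Combinatorics.SimpleGraph.RootedForestMatrixTree
  Literature.Combinatorics.SimpleGraph.RootedSpanningForests
  Literature.Combinatorics.SimpleGraph.LaplacianCoefficientsForests

variable {V : Type*} [Fintype V] [DecidableEq V]

/-! ### § Parametric — Theorem 3′: `det(1 + tL) = Σ_s t^{|s|} · #{in-forests with non-root set s}` -/

section Parametric

variable (R : Type*) [CommRing R] (G : SimpleGraph V) [DecidableRel G.Adj]

/-- **Chebotarev–Agaev Thm 3′ (parametric matrix-forest theorem), every commutative ring: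
`det(I + tL) = σ(t) = Σ_k σ_k t^k`** — written as a sum over the non-root sets `s`: the
coefficient of `t^{|s|}` collects the in-forests of `G` whose set of non-root vertices is `s`
(parent maps rooted at `sᶜ` with arcs along edges of `G`), their number being the principal
minor `det L|_{s×s}` (Theorem 2, the tree's `det_lapMatrix_submatrix_eq_card_rootedForests`).
[cite: ChebotarevAgaev2002, §4 Theorem 3′ with §3 Theorem 2] [cite: Knill2013, Theorem 2] -/
theorem det_one_add_smul_lapMatrix (t : R) :
    (1 + t • G.lapMatrix R).det =
      ∑ s : Finset V, t ^ #s *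
        (Nat.card {τ : V → V //
          IsForestOn (univ : Finset V) sᶜ τ ∧ ∀ v ∈ s, G.Adj v (τ v)} : R) := by
  rw [add_comm, ← Matrix.diagonal_one, Literature.Analysis.Matrix.det_add_diagonal_eq_sum_minors]
  refine sum_congr rfl fun s _ => ?_
  simp only [prod_const_one, one_mul]
  rw [show (t • G.lapMatrix R).submatrix (Subtype.val : s → V) Subtype.val =
      t • (G.lapMatrix R).submatrix Subtype.val Subtype.val from rfl,
    Matrix.det_smul, Fintype.card_coe, det_lapMatrix_submatrix_eq_card_rootedForests R G s]

/-- Theorem 3′ in subgraph form: the coefficient of `t^{|s|}` is the number of acyclic spanning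
subgraphs `F ≤ G` with exactly one vertex of `sᶜ` in each component (the tree's
`card_rootedForests_eq_card_rootedSpanningForests`).
[cite: ChebotarevAgaev2002, §4 Theorem 3′] [cite: Knill2013, Theorem 2] -/
theorem det_one_add_smul_lapMatrix_eq_sum_card_rootedSpanningForests (t : R) :
    (1 + t • G.lapMatrix R).det =
      ∑ s : Finset V, t ^ #s *
        (Nat.card {F : SimpleGraph V //
          F ≤ G ∧ F.IsAcyclic ∧ ∀ v, ∃! r, r ∉ s ∧ F.Reachable v r} : R) := by
  rw [det_one_add_smul_lapMatrix R G t]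
  refine sum_congr rfl fun s _ => ?_
  rw [card_rootedForests_eq_card_rootedSpanningForests G s]

end Parametric

/-! ### § InForest — roots are the fixed points, arcs the moved points -/

section InForest

variable {s : Finset V} {τ : V → V}

/-- For a parent map rooted at `sᶜ`, the non-root vertices are exactly the moved points (roots are
fixed; a fixed non-root would never reach a root). [folklore] -/
private theorem eq_filter_ne (h : IsForestOn (univ : Finset V) sᶜ τ) :
    s = univ.filter fun v => τ v ≠ v := by
  ext v
  simp only [mem_filter, mem_univ, true_and]
  constructor
  · intro hv hfix
    obtain ⟨n, hn⟩ := (isForestOn_univ_compl_iff.1 h).2 v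
    rw [iterate_fixed hfix] at hn
    exact hn hv
  · intro hne
    by_contra hv
    exact hne ((isForestOn_univ_compl_iff.1 h).1 v hv)

/-- The complement of the moved points is the fixed points. [folklore] -/
private theorem compl_filter_ne (τ : V → V) :
    (univ.filter fun v => τ v ≠ v)ᶜ = univ.filter fun v => τ v = v := by
  ext v
  simp only [mem_compl, mem_filter, mem_univ, true_and, ne_eq, not_not]

/-- **Pairs `(s, τ)` versus in-forests**: `τ` is rooted at `sᶜ` with arcs along `G` iff `τ` is an
in-forest of `G` (rooted at its fixed points) and `s` is its set of moved points. [folklore] -/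
private theorem rooted_iff (G : SimpleGraph V) (s : Finset V) (τ : V → V) :
    (IsForestOn (univ : Finset V) sᶜ τ ∧ ∀ v ∈ s, G.Adj v (τ v)) ↔
      s = (univ.filter fun v => τ v ≠ v) ∧
        (IsForestOn (univ : Finset V) (univ.filter fun v => τ v = v) τ ∧
          ∀ v, τ v ≠ v → G.Adj v (τ v)) := by
  constructor
  · rintro ⟨h, hadj⟩
    have hs := eq_filter_ne h
    refine ⟨hs, ?_, fun v hv => hadj v ?_⟩
    · rw [← compl_filter_ne, ← hs]
      exact h
    · rw [hs]
      exact mem_filter.2 ⟨mem_univ _, hv⟩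
  · rintro ⟨hs, h, hadj⟩
    subst hs
    refine ⟨by rwa [compl_filter_ne], fun v hv => hadj v (mem_filter.1 hv).2⟩

end InForest

/-! ### § Count — Knill Thm 2 and Thm 1 / Chebotarev–Agaev Thm 3 -/

section Count

variable (R : Type*) [CommRing R] (G : SimpleGraph V) [DecidableRel G.Adj]

open Classical in
/-- **Knill Thm 2 (forest colouring theorem) / Chebotarev–Agaev Thm 3′: `det(1 + tL) = Σ_τ
t^{#arcs(τ)}`** over the in-forests `τ` of `G` («the number of rooted `k`-colored spanning
forests»: each of the `#arcs` arcs — the moved points — coloured independently), every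
commutative ring. [cite: Knill2013, Theorem 2] [cite: ChebotarevAgaev2002, §4 Theorem 3′] -/
theorem det_one_add_smul_lapMatrix_eq_sum_pow (t : R) :
    (1 + t • G.lapMatrix R).det =
      ∑ τ ∈ univ.filter (fun τ : V → V =>
          IsForestOn (univ : Finset V) (univ.filter fun v => τ v = v) τ ∧
            ∀ v, τ v ≠ v → G.Adj v (τ v)),
        t ^ #(univ.filter fun v => τ v ≠ v) := by
  rw [det_one_add_smul_lapMatrix R G t]
  have hN : ∀ s : Finset V,
      (Nat.card {τ : V → V //
          IsForestOn (univ : Finset V) sᶜ τ ∧ ∀ v ∈ s, G.Adj v (τ v)} : R) =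
        ∑ τ : V → V,
          if IsForestOn (univ : Finset V) sᶜ τ ∧ ∀ v ∈ s, G.Adj v (τ v) then (1 : R) else 0 := by
    intro s
    rw [Nat.card_eq_fintype_card, Fintype.card_subtype, natCast_card_filter]
  simp_rw [hN, mul_sum, mul_boole]
  rw [sum_comm, sum_filter]
  refine sum_congr rfl fun τ _ => ?_
  simp_rw [rooted_iff]
  by_cases hQ : IsForestOn (univ : Finset V) (univ.filter fun v => τ v = v) τ ∧
      ∀ v, τ v ≠ v → G.Adj v (τ v)
  · have h2 : (∀ v, τ v ≠ v → G.Adj v (τ v)) ↔ True := iff_true_intro hQ.2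
    simp only [hQ.1, h2, and_true, sum_ite_eq', mem_univ, if_true]
  · simp only [hQ, and_false, if_false, sum_const_zero]

open Classical in
/-- **The matrix-forest theorem (Chebotarev–Shamis; Chebotarev–Agaev Thm 3 `σ = det(I+L)`;
Knill Thm 1 with «the number of simple outdegree=1 acyclic digraphs contained in `G`»)**:
`det(1 + L)` is the number of in-forests of `G` — parent maps `τ : V → V` every orbit of which
ends in a fixed point, with all arcs `v → τ v` along edges of `G`; every commutative ring.
[cite: ChebotarevAgaev2002, §4 Theorem 3] [cite: Knill2013, Theorem 1 and §2 Remark] -/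
theorem det_one_add_lapMatrix_eq_card_inForests :
    (1 + G.lapMatrix R).det =
      (Nat.card {τ : V → V //
        IsForestOn (univ : Finset V) (univ.filter fun v => τ v = v) τ ∧
          ∀ v, τ v ≠ v → G.Adj v (τ v)} : R) := by
  have h := det_one_add_smul_lapMatrix_eq_sum_pow R G 1
  rw [one_smul] at h
  rw [h, Nat.card_eq_fintype_card, Fintype.card_subtype]
  simp only [one_pow, sum_const, nsmul_eq_mul, mul_one]

omit [DecidableRel G.Adj] in
/-- Rooted spanning forests `(F, roots)` of `G` regrouped by the root set: their number is the sum
over `s` of the in-forests with non-root set `s`. [folklore] -/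
private theorem card_rootedSpanningForests_eq_sum :
    Nat.card {p : SimpleGraph V × Finset V //
        p.1 ≤ G ∧ p.1.IsAcyclic ∧ ∀ v, ∃! r, r ∈ p.2 ∧ p.1.Reachable v r} =
      ∑ s : Finset V, Nat.card {τ : V → V //
        IsForestOn (univ : Finset V) sᶜ τ ∧ ∀ v ∈ s, G.Adj v (τ v)} := by
  classical
  simp_rw [card_rootedForests_eq_card_rootedSpanningForests G]
  -- roots `sᶜ ↦ s`
  have hc : ∑ s : Finset V, Nat.card {F : SimpleGraph V //
        F ≤ G ∧ F.IsAcyclic ∧ ∀ v, ∃! r, r ∉ s ∧ F.Reachable v r} =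
      ∑ s : Finset V, Nat.card {F : SimpleGraph V //
        F ≤ G ∧ F.IsAcyclic ∧ ∀ v, ∃! r, r ∈ s ∧ F.Reachable v r} := by
    refine Fintype.sum_equiv ⟨compl, compl, compl_compl, compl_compl⟩ _ _ fun s => ?_
    simp only [Equiv.coe_fn_mk, mem_compl]
  rw [hc, ← Nat.card_sigma]
  exact Nat.card_congr (((Equiv.prodComm _ _).subtypeEquiv fun p => Iff.rfl).trans
    (Equiv.subtypeProdEquivSigmaSubtype fun (s : Finset V) (F : SimpleGraph V) =>
      F ≤ G ∧ F.IsAcyclic ∧ ∀ v, ∃! r, r ∈ s ∧ F.Reachable v r))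

/-- **Knill Thm 1 as printed: `det(1 + L)` is the number of rooted spanning forests contained in
`G`** — pairs (spanning forest `F ≤ G`, a set of roots with exactly one root in each tree of `F`);
every commutative ring. [cite: Knill2013, Theorem 1] [cite: ChebotarevAgaev2002, §4 Theorem 3] -/
theorem det_one_add_lapMatrix_eq_card_rootedSpanningForests :
    (1 + G.lapMatrix R).det =
      (Nat.card {p : SimpleGraph V × Finset V //
        p.1 ≤ G ∧ p.1.IsAcyclic ∧ ∀ v, ∃! r, r ∈ p.2 ∧ p.1.Reachable v r} : R) := by
  have h := det_one_add_smul_lapMatrix R G 1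
  rw [one_smul] at h
  simp only [one_pow, one_mul] at h
  rw [h, card_rootedSpanningForests_eq_sum G, Nat.cast_sum]

omit [DecidableRel G.Adj] in
open Classical in
/-- Rooted spanning forests regrouped by the underlying forest: `Σ_{F ≤ G acyclic} p(F)`,
`p(F) = ∏_c |c|` the number of root choices (the tree's `card_filter_isRootSet_eq_prod`).
[folklore] -/
private theorem card_rootedSpanningForests_eq_sum_prod :
    Nat.card {p : SimpleGraph V × Finset V //
        p.1 ≤ G ∧ p.1.IsAcyclic ∧ ∀ v, ∃! r, r ∈ p.2 ∧ p.1.Reachable v r} =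
      ∑ F ∈ univ.filter (fun F : SimpleGraph V => F ≤ G ∧ F.IsAcyclic),
        ∏ c : F.ConnectedComponent, Fintype.card c.supp := by
  rw [Nat.card_congr (Equiv.subtypeProdEquivSigmaSubtype fun (F : SimpleGraph V) (s : Finset V) =>
      F ≤ G ∧ F.IsAcyclic ∧ ∀ v, ∃! r, r ∈ s ∧ F.Reachable v r), Nat.card_sigma, sum_filter]
  refine sum_congr rfl fun F _ => ?_
  by_cases hF : F ≤ G ∧ F.IsAcyclic
  · rw [if_pos hF, Nat.card_congr (Equiv.subtypeEquivRight (fun s => show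
        (F ≤ G ∧ F.IsAcyclic ∧ ∀ v, ∃! r, r ∈ s ∧ F.Reachable v r) ↔
          ∀ v, ∃! r, r ∈ s ∧ F.Reachable v r from
        ⟨fun h => h.2.2, fun h => ⟨hF.1, hF.2, h⟩⟩)),
      Nat.card_eq_fintype_card, Fintype.card_subtype, card_filter_isRootSet_eq_prod]
  · rw [if_neg hF]
    haveI : IsEmpty {s : Finset V // F ≤ G ∧ F.IsAcyclic ∧ ∀ v, ∃! r, r ∈ s ∧ F.Reachable v r} :=
      ⟨fun x => hF ⟨x.2.1, x.2.2.1⟩⟩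
    exact Nat.card_of_isEmpty

open Classical in
/-- **`det(1 + L) = Σ_{F ≤ G acyclic} ∏_{c component of F} |c|`** — the rooted spanning forests
counted forest by forest (`∏_c |c|` root choices for the spanning forest `F`); every commutative
ring. [cite: Knill2013, Theorem 1] [cite: ChebotarevAgaev2002, §4 Theorem 3]
[cite: Biggs1974, Theorem 7.5 (proof: p(Φ) ways of omitting one vertex from each component)] -/
theorem det_one_add_lapMatrix_eq_sum_forests_prod :
    (1 + G.lapMatrix R).det =
      ∑ F ∈ univ.filter (fun F : SimpleGraph V => F ≤ G ∧ F.IsAcyclic),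
        ∏ c : F.ConnectedComponent, (Fintype.card c.supp : R) := by
  rw [det_one_add_lapMatrix_eq_card_rootedSpanningForests R G]
  exact_mod_cast congrArg (Nat.cast : ℕ → R) (card_rootedSpanningForests_eq_sum_prod G)

end Count

/-! ### § Examples — `K_n` (Knill §3 (2)) and cones -/

section Examples

variable (R : Type*) [CommRing R]

/-- `χ_M(−1) = (−1)^m det(1 + M)`. [folklore] -/
private theorem eval_charpoly_neg_one {ι : Type*} [Fintype ι] [DecidableEq ι]
    (M : Matrix ι ι R) : M.charpoly.eval (-1) = (-1) ^ Fintype.card ι * (1 + M).det := by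
  rw [Matrix.eval_charpoly, ← Matrix.det_neg]
  congr 1
  ext i j
  simp only [Matrix.scalar_apply, Matrix.sub_apply, Matrix.diagonal_apply, Matrix.neg_apply,
    Matrix.add_apply, Matrix.one_apply]
  split_ifs <;> ring

/-- **Knill §3 (2): `det(1 + L(K_n)) = (n+1)^{n−1}`** (from `χ(L(K_n)) = X (X − n)^{n−1}`, the
tree's `charpoly_lapMatrix_top`, at `X = −1`); every commutative ring.
[cite: Knill2013, §3 Examples (2)] -/
theorem det_one_add_lapMatrix_top [DecidableRel (⊤ : SimpleGraph V).Adj] :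
    (1 + (⊤ : SimpleGraph V).lapMatrix R).det =
      ((Fintype.card V : R) + 1) ^ (Fintype.card V - 1) := by
  rcases isEmpty_or_nonempty V with hV | hV
  · simp [Matrix.det_isEmpty, Fintype.card_eq_zero]
  obtain ⟨k, hk⟩ : ∃ k, Fintype.card V = k + 1 :=
    Nat.exists_eq_succ_of_ne_zero Fintype.card_ne_zero
  have hev := eval_charpoly_neg_one R ((⊤ : SimpleGraph V).lapMatrix R)
  rw [LaplacianComplementCharpoly.charpoly_lapMatrix_top (V := V) R, hk, Nat.add_sub_cancel]
    at hev
  rw [hk, Nat.add_sub_cancel]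
  push_cast
  simp only [eval_mul, eval_pow, eval_sub, eval_X, eval_C, Nat.cast_add, Nat.cast_one] at hev
  -- `hev : (−1) · (−1 − (k+1))^k = (−1)^{k+1} · det(1 + L)`; cancel the unit `(−1)^{k+1}`
  have h1 : ((-1 : R) - ((k : R) + 1)) ^ k = (-1) ^ k * (((k : R) + 1) + 1) ^ k := by
    rw [← mul_pow]
    congr 1
    ring
  rw [h1] at hev
  have h2 : (-1 : R) ^ (k + 1) * (1 + (⊤ : SimpleGraph V).lapMatrix R).det =
      (-1) ^ (k + 1) * (((k : R) + 1) + 1) ^ k := by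
    rw [← hev]
    ring
  exact (isUnit_one.neg.pow (k + 1)).mul_left_cancel h2

open Classical in
/-- **`n` labelled points carry `(n+1)^{n−1}` rooted forests** (in-forests of `K_n`: parent maps
on `n` points every orbit of which ends in a fixed point) — Knill: «`f(K_n) = (n+1)^{n−1}` looks
like the Cayley formula». [cite: Knill2013, §3 Examples (2) with Theorem 1] -/
theorem card_inForests_top :
    Nat.card {τ : V → V // IsForestOn (univ : Finset V) (univ.filter fun v => τ v = v) τ} =
      (Fintype.card V + 1) ^ (Fintype.card V - 1) := by
  have h := det_one_add_lapMatrix_eq_card_inForests ℤ (⊤ : SimpleGraph V)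
  rw [det_one_add_lapMatrix_top] at h
  have h' : ((Nat.card {τ : V → V //
      IsForestOn (univ : Finset V) (univ.filter fun v => τ v = v) τ ∧
        ∀ v, τ v ≠ v → (⊤ : SimpleGraph V).Adj v (τ v)} : ℕ) : ℤ) =
      (((Fintype.card V + 1) ^ (Fintype.card V - 1) : ℕ) : ℤ) := by
    rw [← h]
    push_cast
    ring
  rw [← Nat.cast_injective h']
  refine Nat.card_congr (Equiv.subtypeEquivRight fun τ => ?_)
  simp only [SimpleGraph.top_adj, ne_eq]
  exact ⟨fun hτ => ⟨hτ, fun v hv h => hv h.symm⟩, fun hτ => hτ.1⟩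

open Classical in
/-- **Spanning trees of a cone = in-forests of its base.**  If `v` is adjacent to every other
vertex of `G`, the spanning trees of `G` are equinumerous with the in-forests (rooted spanning
forests) of `G − v`: the tree's cone formula `t(G) = det(1 + L(G − v))`
(`ConeSpanningTrees.card_spanningTrees_of_dominating`) combined with the matrix-forest theorem.
[cite: ChebotarevAgaev2002, §4 Theorem 3] [cite: GrossSaccomanSuffel2013, Lemma 3.3 with Thm 1.5] -/
theorem card_spanningTrees_eq_card_inForests_of_dominating (G : SimpleGraph V)
    [DecidableRel G.Adj] {v : V} (hv : ∀ w, w ≠ v → G.Adj v w) :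
    Nat.card {T : SimpleGraph V // T ≤ G ∧ T.IsTree} =
      Nat.card {τ : ↥({v}ᶜ : Set V) → ↥({v}ᶜ : Set V) //
        IsForestOn (univ : Finset ↥({v}ᶜ : Set V)) (univ.filter fun w => τ w = w) τ ∧
          ∀ w, τ w ≠ w → (G.induce ({v}ᶜ : Set V)).Adj w (τ w)} := by
  have h := ConeSpanningTrees.card_spanningTrees_of_dominating G hv
  rw [det_one_add_lapMatrix_eq_card_inForests] at h
  exact_mod_cast h

end Examples

/-! ### § Adjugate — the diagonal of `Q = adj(I + L)` (Chebotarev–Agaev Thm 3) -/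

section Adjugate

variable (R : Type*) [CommRing R] (G : SimpleGraph V) [DecidableRel G.Adj]

open Classical in
/-- **Chebotarev–Agaev Thm 3, the diagonal of `Q = adj(I + L)`**: the `(x,x)` cofactor of `I + L`
is the number of in-forests of `G` in which `x` is a root («the `(i,j)` entry … is the total
weight of in-forests … where `i` belongs to a tree converging to `j`», read at `i = j = x`: `x`
lies in the tree converging to `x` iff `x` is a root); every commutative ring.  Proof: by
row-linearity `det(1 + L + E_xx) = det(1 + L) + adj(1 + L)_xx`, while
`det(L + diag(1,…,2_x,…,1)) = Σ_S 2^{[x ∉ S]} det L|_S` doubles exactly the in-forests rooted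
outside `S ∌ x`. [cite: ChebotarevAgaev2002, §4 Theorem 3 (Q = adj(I+L), diagonal)] -/
theorem adjugate_one_add_lapMatrix_apply_self (x : V) :
    (1 + G.lapMatrix R).adjugate x x =
      (Nat.card {τ : V → V //
        (IsForestOn (univ : Finset V) (univ.filter fun v => τ v = v) τ ∧
          ∀ v, τ v ≠ v → G.Adj v (τ v)) ∧ τ x = x} : R) := by
  -- (1) row-linearity in row `x`
  have h1 : ((1 + G.lapMatrix R).updateRow x ((1 + G.lapMatrix R) x + Pi.single x 1)).det =
      (1 + G.lapMatrix R).det + (1 + G.lapMatrix R).adjugate x x := by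
    rw [Matrix.det_updateRow_add, Matrix.updateRow_eq_self, Matrix.adjugate_apply]
  -- (2) the updated matrix is `L + diag(d)`, `d = 1 + [· = x]`
  have h2 : (1 + G.lapMatrix R).updateRow x ((1 + G.lapMatrix R) x + Pi.single x 1) =
      G.lapMatrix R + Matrix.diagonal (fun v => if v = x then (2 : R) else 1) := by
    ext i j
    simp only [Matrix.updateRow_apply, Pi.add_apply, Matrix.add_apply, Matrix.one_apply,
      Pi.single_apply, Matrix.diagonal_apply]
    by_cases hi : i = x
    · subst hi
      by_cases hij : i = j
      · subst hij
        simp only [if_true]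
        ring
      · rw [if_pos rfl, if_neg hij, if_neg (Ne.symm hij), if_neg hij]
        ring
    · by_cases hij : i = j
      · subst hij
        rw [if_neg hi, if_pos rfl, if_pos rfl, if_neg hi]
        ring
      · rw [if_neg hi, if_neg hij, if_neg hij]
        ring
  -- (3) expand `det(L + diag d)` by principal minors and compare with `det(1 + L) = Σ_S N(S)`
  have hdet : (1 + G.lapMatrix R).det = ∑ s : Finset V,
      (Nat.card {τ : V → V //
        IsForestOn (univ : Finset V) sᶜ τ ∧ ∀ v ∈ s, G.Adj v (τ v)} : R) := by
    have h := det_one_add_smul_lapMatrix R G 1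
    rw [one_smul] at h
    simpa only [one_pow, one_mul] using h
  have h3 : (G.lapMatrix R + Matrix.diagonal (fun v => if v = x then (2 : R) else 1)).det =
      (1 + G.lapMatrix R).det + ∑ s : Finset V, if x ∉ s then
        (Nat.card {τ : V → V //
          IsForestOn (univ : Finset V) sᶜ τ ∧ ∀ v ∈ s, G.Adj v (τ v)} : R) else 0 := by
    rw [Literature.Analysis.Matrix.det_add_diagonal_eq_sum_minors, hdet, ← sum_add_distrib]
    refine sum_congr rfl fun s _ => ?_
    rw [prod_ite_eq', det_lapMatrix_submatrix_eq_card_rootedForests R G s]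
    by_cases hx : x ∈ s
    · rw [if_neg (fun h => (mem_compl.1 h) hx), if_neg (fun h => h hx)]
      ring
    · rw [if_pos (mem_compl.2 hx), if_pos hx]
      ring
  rw [h2, h3, add_right_inj] at h1
  rw [← h1]
  -- (4) count: the pairs `(s, τ)` with `x ∉ s` are the in-forests fixing `x`
  have hN : ∀ s : Finset V,
      (Nat.card {τ : V → V //
          IsForestOn (univ : Finset V) sᶜ τ ∧ ∀ v ∈ s, G.Adj v (τ v)} : R) =
        ∑ τ : V → V,
          if IsForestOn (univ : Finset V) sᶜ τ ∧ ∀ v ∈ s, G.Adj v (τ v) then (1 : R) else 0 := by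
    intro s
    rw [Nat.card_eq_fintype_card, Fintype.card_subtype, natCast_card_filter]
  have hite : ∀ s : Finset V, (if x ∉ s then
      (Nat.card {τ : V → V //
        IsForestOn (univ : Finset V) sᶜ τ ∧ ∀ v ∈ s, G.Adj v (τ v)} : R) else 0) =
      ∑ τ : V → V, if x ∉ s ∧ (IsForestOn (univ : Finset V) sᶜ τ ∧ ∀ v ∈ s, G.Adj v (τ v))
        then (1 : R) else 0 := by
    intro s
    by_cases hx : x ∈ s
    · rw [if_neg (fun h => h hx)]
      symm
      refine sum_eq_zero fun τ _ => ?_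
      rw [if_neg (fun h => h.1 hx)]
    · rw [if_pos hx, hN s]
      refine sum_congr rfl fun τ _ => ?_
      by_cases hP : IsForestOn (univ : Finset V) sᶜ τ ∧ ∀ v ∈ s, G.Adj v (τ v)
      · rw [if_pos hP, if_pos ⟨hx, hP⟩]
      · rw [if_neg hP, if_neg (fun h => hP h.2)]
  simp_rw [hite]
  rw [sum_comm, Nat.card_eq_fintype_card, Fintype.card_subtype, natCast_card_filter]
  refine sum_congr rfl fun τ _ => ?_
  -- for a fixed `τ`: at most the single term `s = moved(τ)`
  have key : ∀ s : Finset V,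
      (x ∉ s ∧ (IsForestOn (univ : Finset V) sᶜ τ ∧ ∀ v ∈ s, G.Adj v (τ v))) ↔
        (s = (univ.filter fun v => τ v ≠ v) ∧
          ((IsForestOn (univ : Finset V) (univ.filter fun v => τ v = v) τ ∧
            ∀ v, τ v ≠ v → G.Adj v (τ v)) ∧ τ x = x)) := by
    intro s
    rw [rooted_iff]
    constructor
    · rintro ⟨hxs, hs, hQ⟩
      refine ⟨hs, hQ, ?_⟩
      by_contra hx
      exact hxs (hs ▸ mem_filter.2 ⟨mem_univ _, hx⟩)
    · rintro ⟨hs, hQ, hx⟩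
      refine ⟨?_, hs, hQ⟩
      rw [hs, mem_filter]
      exact fun h => h.2 hx
  by_cases hQx : (IsForestOn (univ : Finset V) (univ.filter fun v => τ v = v) τ ∧
      ∀ v, τ v ≠ v → G.Adj v (τ v)) ∧ τ x = x
  · rw [if_pos hQx, Finset.sum_eq_single (univ.filter fun v => τ v ≠ v)]
    · rw [if_pos ((key _).2 ⟨rfl, hQx⟩)]
    · intro s _ hs
      exact if_neg (fun h => hs ((key s).1 h).1)
    · intro h
      exact absurd (mem_univ _) h
  · rw [if_neg hQx]
    refine sum_eq_zero fun s _ => ?_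
    exact if_neg (fun h => hQx ((key s).1 h).2)

end Adjugate

/-! ### § More examples (Knill §3): `k = −1`, the star `S_n`, the cycle `C_n` -/

section MoreExamples

variable (R : Type*) [CommRing R]

open Classical in
/-- **Knill, `k = −1`: `det(1 − L) = #{even in-forests} − #{odd in-forests}`** («We can also look
at `k = −1`, in which case we count forests with odd number of [edges] with a negative sign»):
`det(1 − L) = Σ_τ (−1)^{#arcs(τ)}` over the in-forests of `G`; every commutative ring.
[cite: Knill2013, Theorem 2 (remark k = −1)] -/
theorem det_one_sub_lapMatrix_eq_sum_neg_one_pow (G : SimpleGraph V) [DecidableRel G.Adj] :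
    (1 - G.lapMatrix R).det =
      ∑ τ ∈ univ.filter (fun τ : V → V =>
          IsForestOn (univ : Finset V) (univ.filter fun v => τ v = v) τ ∧
            ∀ v, τ v ≠ v → G.Adj v (τ v)),
        (-1 : R) ^ #(univ.filter fun v => τ v ≠ v) := by
  rw [← det_one_add_smul_lapMatrix_eq_sum_pow R G (-1), neg_one_smul, sub_eq_add_neg]

/-- **Knill §3 (3): `f(S_n) = (n+1) 2^{n−2}`** — the star `K_{1,b}` (`n = b + 1` vertices, realised
as `completeBipartiteGraph U W` with `|U| = 1`, `|W| = b ≥ 1`) has `det(1 + L) = (b+2) · 2^{b−1}`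
(from the tree's `charpoly_lapMatrix_star`: `χ(L(K_{1,b})) = X (X − (b+1)) (X − 1)^{b−1}` at
`X = −1`); every commutative ring. [cite: Knill2013, §3 Examples (3)] -/
theorem det_one_add_lapMatrix_star (U W : Type*) [Fintype U] [DecidableEq U] [Fintype W]
    [DecidableEq W] [Nonempty W] (hU : Fintype.card U = 1)
    [DecidableRel (completeBipartiteGraph U W).Adj] :
    (1 + (completeBipartiteGraph U W).lapMatrix R).det =
      ((Fintype.card W : R) + 2) * 2 ^ (Fintype.card W - 1) := by
  obtain ⟨c, hc⟩ : ∃ c, Fintype.card W = c + 1 :=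
    Nat.exists_eq_succ_of_ne_zero Fintype.card_ne_zero
  have hev := eval_charpoly_neg_one R ((completeBipartiteGraph U W).lapMatrix R)
  rw [LaplacianJoinExamples.charpoly_lapMatrix_star U W R hU, Fintype.card_sum, hU, hc,
    Nat.add_sub_cancel] at hev
  rw [hc, Nat.add_sub_cancel]
  simp only [eval_mul, eval_pow, eval_sub, eval_X, eval_C, eval_one, Nat.cast_add,
    Nat.cast_one] at hev
  -- `hev : (−1)(−1 − (c+1+1))(−2)^c = (−1)^{1+(c+1)} det(1 + L)`
  have h2 : (-1 : R) ^ (1 + (c + 1)) * (1 + (completeBipartiteGraph U W).lapMatrix R).det =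
      (-1) ^ (1 + (c + 1)) * ((((c + 1 : ℕ) : R) + 2) * 2 ^ c) := by
    rw [← hev, show ((-1 : R) - 1) = (-1) * 2 by ring, mul_pow]
    push_cast
    ring
  exact (isUnit_one.neg.pow _).mul_left_cancel h2

/-- The real Laplacian of a graph, read in `ℂ`. [folklore] -/
private theorem map_one_add_lapMatrix_real {ι : Type*} [Fintype ι] [DecidableEq ι]
    (G : SimpleGraph ι) [DecidableRel G.Adj] :
    (algebraMap ℝ ℂ).mapMatrix (1 + G.lapMatrix ℝ) = 1 + G.lapMatrix ℂ := by
  ext i j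
  simp only [RingHom.mapMatrix_apply, Matrix.map_apply, Matrix.add_apply, Matrix.one_apply,
    SimpleGraph.lapMatrix, SimpleGraph.degMatrix, Matrix.sub_apply, Matrix.diagonal_apply,
    SimpleGraph.adjMatrix_apply, map_add, map_sub]
  split_ifs <;> simp

/-- **Knill §3 (4): `f(C_n) = ∏_k (1 + 4 sin²(πk/n))`** — the number of rooted spanning forests of
the cycle `C_N` (`N ≥ 3`), i.e. `det(1 + L(C_N))`, from the Laplace spectrum
`2 − 2cos(2πk/N)` of the cycle (the tree's `CycleSpanningTrees.charpoly_lapMatrix_cycleGraph`).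
[cite: Knill2013, §3 Examples (4)] -/
theorem det_one_add_lapMatrix_cycleGraph (n : ℕ) :
    (1 + (SimpleGraph.cycleGraph (n + 3)).lapMatrix ℝ).det =
      ∏ k : Fin (n + 3), (1 + 4 * Real.sin (Real.pi * (k : ℕ) / ((n + 3 : ℕ) : ℝ)) ^ 2) := by
  -- over `ℂ`: `det(1 + L) = ∏ (1 + λ_k)`
  have hev := eval_charpoly_neg_one ℂ ((SimpleGraph.cycleGraph (n + 3)).lapMatrix ℂ)
  rw [CycleSpanningTrees.charpoly_lapMatrix_cycleGraph, eval_prod, Fintype.card_fin] at hev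
  simp only [eval_sub, eval_X, eval_C] at hev
  have hC : (1 + (SimpleGraph.cycleGraph (n + 3)).lapMatrix ℂ).det =
      ∏ k : Fin (n + 3), (1 + (cycleLapEig (n + 3) k : ℂ)) := by
    have h2 : (-1 : ℂ) ^ (n + 3) * (1 + (SimpleGraph.cycleGraph (n + 3)).lapMatrix ℂ).det =
        (-1) ^ (n + 3) * ∏ k : Fin (n + 3), (1 + (cycleLapEig (n + 3) k : ℂ)) := by
      have hneg : (-1 : ℂ) ^ (n + 3) = ∏ _k : Fin (n + 3), (-1 : ℂ) := by
        rw [prod_const, card_univ, Fintype.card_fin]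
      rw [← hev, hneg, ← prod_mul_distrib]
      exact prod_congr rfl fun k _ => by ring
    exact (isUnit_one.neg.pow _).mul_left_cancel h2
  -- read in `ℝ` and unfold `λ_k = 2 − 2cos(2πk/N)`, `3 − 2cos 2x = 1 + 4 sin² x`
  have hR : (1 + (SimpleGraph.cycleGraph (n + 3)).lapMatrix ℝ).det =
      ∏ k : Fin (n + 3), (1 + cycleLapEig (n + 3) k) := by
    have h := (RingHom.map_det (algebraMap ℝ ℂ) (1 + (SimpleGraph.cycleGraph (n + 3)).lapMatrix ℝ))
    rw [map_one_add_lapMatrix_real, hC] at h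
    simp only [Complex.coe_algebraMap] at h
    exact_mod_cast h
  rw [hR]
  refine prod_congr rfl fun k _ => ?_
  rw [cycleLapEig, cycleAngle,
    show 2 * Real.pi * (k.val : ℝ) / ((n + 3 : ℕ) : ℝ) =
      2 * (Real.pi * (k : ℕ) / ((n + 3 : ℕ) : ℝ)) by ring, Real.cos_two_mul, Real.cos_sq']
  ring

end MoreExamples

end Literature.Combinatorics.SimpleGraph.MatrixForestTheorem
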